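import Mathlib.Analysis.SumIntegralExpDecay
import Mathlib.Analysis.SpecialFunctions.Gamma.BohrMollerup
import Literature.Probability.Percolation.HutchcroftVolumeTailExponential
import HarnessLib

/-!
# Hutchcroft 2020, §4.1: cluster moments from exponential volume tails (the calculus of eq. (4.2))

Source: T. Hutchcroft, Probab. Math. Phys. 1 (2020), arXiv:1901.10363, §4.1, display (4.2):
"`E[|K|^k] = k ∫_0^∞ x^{k−1} P(|K| ≥ x) dx ⪯ k ∫ x^α e^{−εx} dx = k Γ(α+1) ε^{−α−1} ≤ k! ε^{−α−1}`".
The three ingredients, for the `ℕ∞`-valued cluster size `|C(0)|` of bond percolation (moments as `∫⁻` in `[0,∞]`,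
no integrability needed):

* `pow_le_sum_range_mul_pow` / `lintegral_encard_pow_le_tsum` — the discrete layer cake
  `E|C|^k ≤ ∑_{n ≥ 1} k n^{k−1} P(|C| ≥ n)` (`m^k = ∑_{n<m} ((n+1)^k − n^k)`, `(n+1)^k − n^k ≤ k (n+1)^{k−1}`);
* `sum_Icc_rpow_mul_exp_neg_le` — `∑_{i=1}^{M} i^q e^{−c i} ≤ e^c Γ(q+1)/c^{q+1}` for real `q ≥ 0` (Mathlib's
  `sum_Iic_pow_mul_exp_neg_le` for natural exponents; the same sum–integral comparison with
  `integral_rpow_mul_exp_neg_mul_Ioi`);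
* `Gamma_le_factorial` — `Γ(x) ≤ (k−1)!` for `k − 1 ≤ x ≤ k`, `k ≥ 2` (convexity on `[1,2]`, monotonicity on `[2,∞)`),
  the step "`k Γ(α+1) ≤ k!`".

The assembled moment bounds (Thm 1.1 second bullet, Thm 1.2) are in `HutchcroftMomentBounds.lean`.
-/

noncomputable section

namespace Literature.Probability.Percolation

open _root_.MeasureTheory Finset Real Set
open scoped ENNReal Nat

namespace HutchcroftMoments

/-! ### The discrete layer cake `m^k ≤ ∑_{n<m} k (n+1)^{k-1}` -/

/-- `(n+1)^k − n^k ≤ k (n+1)^{k−1}` (in `ℝ`, via `a^k − b^k = (a − b) ∑ a^i b^{k−1−i}`).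
[cite: Hutchcroft2020, §4.1 eq. (4.2) (E|K|^k = k ∫ x^{k−1} P(|K| ≥ x) dx)] -/
theorem pow_succ_sub_pow_le (k n : ℕ) :
    ((n : ℝ) + 1) ^ k - (n : ℝ) ^ k ≤ k * ((n : ℝ) + 1) ^ (k - 1) := by
  have h := geom_sum₂_mul ((n : ℝ) + 1) (n : ℝ) k
  rw [show (n : ℝ) + 1 - n = 1 by ring, mul_one] at h
  rw [← h]
  calc ∑ i ∈ Finset.range k, ((n : ℝ) + 1) ^ i * (n : ℝ) ^ (k - 1 - i)
      ≤ ∑ _i ∈ Finset.range k, ((n : ℝ) + 1) ^ (k - 1) := by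
        refine Finset.sum_le_sum fun i hi => ?_
        rw [Finset.mem_range] at hi
        calc ((n : ℝ) + 1) ^ i * (n : ℝ) ^ (k - 1 - i) ≤ ((n : ℝ) + 1) ^ i * ((n : ℝ) + 1) ^ (k - 1 - i) :=
              mul_le_mul_of_nonneg_left (pow_le_pow_left₀ (Nat.cast_nonneg n) (by linarith) _)
                (pow_nonneg (by positivity) _)
          _ = ((n : ℝ) + 1) ^ (k - 1) := by rw [← pow_add]; congr 1; omega
    _ = k * ((n : ℝ) + 1) ^ (k - 1) := by rw [Finset.sum_const, Finset.card_range, nsmul_eq_mul]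

/-- `m^k ≤ ∑_{n<m} k (n+1)^{k−1}` (naturals). [cite: Hutchcroft2020, §4.1 eq. (4.2) (layer cake)] -/
theorem pow_le_sum_range_mul_pow {k : ℕ} (hk : 1 ≤ k) (m : ℕ) :
    m ^ k ≤ ∑ n ∈ Finset.range m, k * (n + 1) ^ (k - 1) := by
  have h : ((m : ℝ)) ^ k ≤ ∑ n ∈ Finset.range m, (k : ℝ) * ((n : ℝ) + 1) ^ (k - 1) := by
    induction m with
    | zero => simp [zero_pow (by omega : k ≠ 0)]
    | succ m ih =>
      rw [Finset.sum_range_succ, Nat.cast_succ]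
      have := pow_succ_sub_pow_le k m
      linarith
  exact_mod_cast h

/-- Pointwise layer cake in `[0,∞]` for an `ℕ∞`-valued size `m` (`k ≥ 1`):
`m^k ≤ ∑_{n ≥ 0} k (n+1)^{k−1} 𝟙{n+1 ≤ m}`. [cite: Hutchcroft2020, §4.1 eq. (4.2) (layer cake)] -/
theorem toENNReal_pow_le_tsum {k : ℕ} (hk : 1 ≤ k) (m : ℕ∞) :
    ((m : ℝ≥0∞)) ^ k ≤ ∑' n : ℕ, ((k * (n + 1) ^ (k - 1) : ℕ) : ℝ≥0∞) * (if ((n : ℕ∞) + 1 ≤ m) then 1 else 0) := by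
  induction m using ENat.recTopCoe with
  | top =>
    have hterm : ∀ n : ℕ, (1 : ℝ≥0∞) ≤ ((k * (n + 1) ^ (k - 1) : ℕ) : ℝ≥0∞) * (if ((n : ℕ∞) + 1 ≤ (⊤ : ℕ∞)) then 1 else 0) := by
      intro n
      rw [if_pos le_top, mul_one]
      have : 1 ≤ k * (n + 1) ^ (k - 1) := Nat.one_le_iff_ne_zero.2 (by positivity)
      exact_mod_cast this
    have htop : ∑' n : ℕ, ((k * (n + 1) ^ (k - 1) : ℕ) : ℝ≥0∞) * (if ((n : ℕ∞) + 1 ≤ (⊤ : ℕ∞)) then 1 else 0) = ⊤ := by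
      refine top_unique ?_
      calc (⊤ : ℝ≥0∞) = ∑' _n : ℕ, (1 : ℝ≥0∞) := (ENNReal.tsum_const_eq_top_of_ne_zero one_ne_zero).symm
        _ ≤ _ := ENNReal.tsum_le_tsum hterm
    rw [htop]; exact le_top
  | coe m =>
    have h := pow_le_sum_range_mul_pow hk m
    calc (((m : ℕ∞) : ℝ≥0∞)) ^ k = ((m ^ k : ℕ) : ℝ≥0∞) := by simp
      _ ≤ ((∑ n ∈ Finset.range m, k * (n + 1) ^ (k - 1) : ℕ) : ℝ≥0∞) := by exact_mod_cast h
      _ = ∑ n ∈ Finset.range m, ((k * (n + 1) ^ (k - 1) : ℕ) : ℝ≥0∞) * (if ((n : ℕ∞) + 1 ≤ (m : ℕ∞)) then 1 else 0) := by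
          rw [Nat.cast_sum]
          refine Finset.sum_congr rfl fun n hn => ?_
          rw [Finset.mem_range] at hn
          rw [if_pos (by exact_mod_cast hn), mul_one]
      _ ≤ _ := ENNReal.sum_le_tsum _

variable {V : Type*} [Countable V]

/-- **LAYER CAKE for cluster moments**: `E_p|C(x)|^k ≤ ∑_{n ≥ 0} k (n+1)^{k−1} P_p(|C(x)| ≥ n+1)` (`k ≥ 1`), in
`[0,∞]`. [cite: Hutchcroft2020, §4.1 eq. (4.2) (E|K|^k = k ∫ x^{k−1} P(|K| ≥ x) dx)] -/
theorem lintegral_encard_pow_le_tsum (G : SimpleGraph V) (x : V) (p : unitInterval) {k : ℕ} (hk : 1 ≤ k) :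
    ∫⁻ ω, ((openCluster ω x).encard : ℝ≥0∞) ^ k ∂(bondPercolation G p)
      ≤ ∑' n : ℕ, ((k * (n + 1) ^ (k - 1) : ℕ) : ℝ≥0∞) * bondPercolation G p (clusterSizeGe x (n + 1)) := by
  classical
  set μ := bondPercolation G p with hμ
  have hind : ∀ n : ℕ, ∀ ω : BondConfig V,
      (clusterSizeGe x (n + 1)).indicator (1 : BondConfig V → ℝ≥0∞) ω =
        if ((n : ℕ∞) + 1 ≤ (openCluster ω x).encard) then 1 else 0 := by
    intro n ω
    have hiff : ω ∈ clusterSizeGe x (n + 1) ↔ (n : ℕ∞) + 1 ≤ (openCluster ω x).encard := by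
      rw [mem_clusterSizeGe, Nat.cast_add, Nat.cast_one]
    by_cases h : (n : ℕ∞) + 1 ≤ (openCluster ω x).encard
    · rw [if_pos h, Set.indicator_of_mem (hiff.2 h)]; rfl
    · rw [if_neg h, Set.indicator_of_notMem (fun hm => h (hiff.1 hm))]
  calc ∫⁻ ω, ((openCluster ω x).encard : ℝ≥0∞) ^ k ∂μ
      ≤ ∫⁻ ω, ∑' n : ℕ, ((k * (n + 1) ^ (k - 1) : ℕ) : ℝ≥0∞)
          * (clusterSizeGe x (n + 1)).indicator (1 : BondConfig V → ℝ≥0∞) ω ∂μ := by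
        refine lintegral_mono fun ω => ?_
        simp_rw [hind]
        exact toENNReal_pow_le_tsum hk _
    _ = ∑' n : ℕ, ∫⁻ ω, ((k * (n + 1) ^ (k - 1) : ℕ) : ℝ≥0∞)
          * (clusterSizeGe x (n + 1)).indicator (1 : BondConfig V → ℝ≥0∞) ω ∂μ :=
        lintegral_tsum fun n =>
          ((measurable_one.indicator (measurableSet_clusterSizeGe x (n + 1))).const_mul _).aemeasurable
    _ = ∑' n : ℕ, ((k * (n + 1) ^ (k - 1) : ℕ) : ℝ≥0∞) * μ (clusterSizeGe x (n + 1)) := by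
        refine tsum_congr fun n => ?_
        rw [lintegral_const_mul _ (measurable_one.indicator (measurableSet_clusterSizeGe x (n + 1))),
          lintegral_indicator_one (measurableSet_clusterSizeGe x (n + 1))]

/-- **From a termwise real bound to a moment bound**: if `k (n+1)^{k−1} P_p(|C(x)| ≥ n+1) ≤ a n` with
`∑_{n<M} a n ≤ B` for all `M` (`a ≥ 0`), then `E_p|C(x)|^k ≤ B` in `[0,∞]`.
[cite: Hutchcroft2020, §4.1 eq. (4.2) (summing the tail bound)] -/
theorem lintegral_encard_pow_le_of_sum_le (G : SimpleGraph V) (x : V) (p : unitInterval) {k : ℕ} (hk : 1 ≤ k)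
    {a : ℕ → ℝ} (ha0 : ∀ n, 0 ≤ a n)
    (ha : ∀ n : ℕ, (k : ℝ) * ((n : ℝ) + 1) ^ (k - 1) * (bondPercolation G p).real (clusterSizeGe x (n + 1)) ≤ a n)
    {B : ℝ} (hB : ∀ M : ℕ, ∑ n ∈ Finset.range M, a n ≤ B) :
    ∫⁻ ω, ((openCluster ω x).encard : ℝ≥0∞) ^ k ∂(bondPercolation G p) ≤ ENNReal.ofReal B := by
  refine (lintegral_encard_pow_le_tsum G x p hk).trans ?_
  have hterm : ∀ n : ℕ, ((k * (n + 1) ^ (k - 1) : ℕ) : ℝ≥0∞) * bondPercolation G p (clusterSizeGe x (n + 1))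
      ≤ ENNReal.ofReal (a n) := by
    intro n
    rw [← ofReal_measureReal (measure_ne_top _ _), ← ENNReal.ofReal_natCast,
      ← ENNReal.ofReal_mul (Nat.cast_nonneg _)]
    refine ENNReal.ofReal_le_ofReal ?_
    have : ((k * (n + 1) ^ (k - 1) : ℕ) : ℝ) = (k : ℝ) * ((n : ℝ) + 1) ^ (k - 1) := by push_cast; ring
    rw [this]; exact ha n
  calc ∑' n : ℕ, ((k * (n + 1) ^ (k - 1) : ℕ) : ℝ≥0∞) * bondPercolation G p (clusterSizeGe x (n + 1))
      ≤ ∑' n : ℕ, ENNReal.ofReal (a n) := ENNReal.tsum_le_tsum hterm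
    _ ≤ ENNReal.ofReal B := by
        refine ENNReal.tsum_le_of_sum_range_le fun M => ?_
        rw [← ENNReal.ofReal_sum_of_nonneg (fun n _ => ha0 n)]
        exact ENNReal.ofReal_le_ofReal (hB M)

/-! ### `∑_{i=1}^{M} i^q e^{−c i} ≤ e^c Γ(q+1) / c^{q+1}` for real `q ≥ 0` -/

/-- The improper integral bound `∫_0^M x^q e^{−cx} dx ≤ Γ(q+1)/c^{q+1}` (`q ≥ 0`, `c > 0`).
[cite: Hutchcroft2020, §4.1 eq. (4.2) (∫ x^α e^{−εx} dx = Γ(α+1) ε^{−α−1})] -/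
theorem intervalIntegral_rpow_mul_exp_neg_le {q M c : ℝ} (hq : 0 ≤ q) (hM : 0 ≤ M) (hc : 0 < c) :
    ∫ x in (0 : ℝ)..M, x ^ q * rexp (-(c * x)) ≤ Real.Gamma (q + 1) / c ^ (q + 1) := by
  have hq1 : (0 : ℝ) < q + 1 := by linarith
  have key := integral_rpow_mul_exp_neg_mul_Ioi hq1 hc
  have hne : (1 / c) ^ (q + 1) * Real.Gamma (q + 1) ≠ 0 := by
    have := Real.Gamma_pos_of_pos hq1; positivity
  have hint : IntegrableOn (fun x ↦ x ^ ((q + 1 : ℝ) - 1) * rexp (-(c * x))) (Ioi 0) :=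
    .of_integral_ne_zero (by rw [key]; exact hne)
  rw [intervalIntegral.integral_of_le hM]
  calc ∫ x in Ioc (0 : ℝ) M, x ^ q * rexp (-(c * x))
    _ = ∫ x in Ioc (0 : ℝ) M, x ^ ((q + 1 : ℝ) - 1) * rexp (-(c * x)) := by
        simp [add_sub_cancel_right]
    _ ≤ ∫ x in Ioi (0 : ℝ), x ^ ((q + 1 : ℝ) - 1) * rexp (-(c * x)) := by
        apply setIntegral_mono_set hint _ Ioc_subset_Ioi_self.eventuallyLE
        filter_upwards [ae_restrict_mem measurableSet_Ioi] with x hx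
        exact mul_nonneg (rpow_nonneg hx.le _) (exp_nonneg _)
    _ = Real.Gamma (q + 1) / c ^ (q + 1) := by
        rw [key, div_rpow zero_le_one hc.le, Real.one_rpow]; ring

/-- **`∑_{i=0}^{M−1} i^q e^{−c i} ≤ e^c Γ(q+1)/c^{q+1}`** for real `q ≥ 0`, `c > 0` (sum–integral comparison with
the monotone factor `x^q` and the antitone factor `e^{−cx}`, as in Mathlib's `sum_Ico_pow_mul_exp_neg_le` for
natural exponents). [cite: Hutchcroft2020, §4.1 eq. (4.2) (k ∫ x^α e^{−εx} dx = k Γ(α+1) ε^{−α−1})] -/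
theorem sum_Ico_rpow_mul_exp_neg_le {q c : ℝ} (hq : 0 ≤ q) (hc : 0 < c) (M : ℕ) :
    ∑ i ∈ Finset.Ico 0 M, (i : ℝ) ^ q * rexp (-(c * i)) ≤ rexp c * Real.Gamma (q + 1) / c ^ (q + 1) := calc
  ∑ i ∈ Finset.Ico 0 M, (i : ℝ) ^ q * rexp (-(c * i))
  _ ≤ ∫ x in (0 : ℕ)..M, x ^ q * rexp (-(c * (x - 1))) := by
    apply sum_mul_Ico_le_integral_of_monotone_antitone
      (f := fun x ↦ x ^ q) (g := fun x ↦ rexp (-(c * x)))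
    · exact Nat.zero_le M
    · intro x hx y _ hxy
      exact Real.rpow_le_rpow (by simpa using hx.1) hxy hq
    · intro x _ y _ hxy
      apply exp_monotone
      simp only [neg_le_neg_iff]
      gcongr
    · simp only [CharP.cast_eq_zero]; exact Real.rpow_nonneg le_rfl q
    · apply exp_nonneg
  _ ≤ (Real.Gamma (q + 1) / c ^ (q + 1)) * rexp c := by
    simp only [mul_sub, mul_one, neg_sub, CharP.cast_eq_zero]
    simp only [sub_eq_add_neg, Real.exp_add, mul_comm (rexp c), ← mul_assoc]
    rw [intervalIntegral.integral_mul_const]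
    gcongr
    exact intervalIntegral_rpow_mul_exp_neg_le hq (by simp) hc
  _ = _ := by ring

/-- The same over `i = 1, …, M`. [cite: Hutchcroft2020, §4.1 eq. (4.2)] -/
theorem sum_Icc_rpow_mul_exp_neg_le {q c : ℝ} (hq : 0 ≤ q) (hc : 0 < c) (M : ℕ) :
    ∑ i ∈ Finset.Icc 1 M, (i : ℝ) ^ q * rexp (-(c * i)) ≤ rexp c * Real.Gamma (q + 1) / c ^ (q + 1) := by
  refine le_trans ?_ (sum_Ico_rpow_mul_exp_neg_le hq hc (M + 1))
  refine Finset.sum_le_sum_of_subset_of_nonneg (fun i hi => ?_) fun i _ _ =>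
    mul_nonneg (Real.rpow_nonneg (Nat.cast_nonneg i) q) (exp_nonneg _)
  rw [Finset.mem_Icc] at hi; rw [Finset.mem_Ico]; omega

/-! ### `k Γ(α + 1) ≤ k!` -/

/-- `Γ(x) ≤ (k−1)!` for `k − 1 ≤ x ≤ k`, `k ≥ 2`: on `[1,2]` by convexity (`Γ(1) = Γ(2) = 1`), on `[2,∞)` by
monotonicity of `Γ`. [cite: Hutchcroft2020, §4.1 eq. (4.2) (the step k Γ(α+1) ≤ k!)] -/
theorem Gamma_le_factorial {x : ℝ} {k : ℕ} (hk : 2 ≤ k) (h1 : (k : ℝ) - 1 ≤ x) (h2 : x ≤ k) :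
    Real.Gamma x ≤ (k - 1)! := by
  by_cases hx2 : 2 ≤ x
  · have hmono := Real.Gamma_strictMonoOn_Ici.monotoneOn hx2 (show (2 : ℝ) ≤ (k : ℝ) by exact_mod_cast hk) h2
    rw [show (k : ℝ) = ((k - 1 : ℕ) : ℝ) + 1 by rw [Nat.cast_sub (by omega)]; push_cast; ring,
      Real.Gamma_nat_eq_factorial] at hmono
    exact hmono
  · push Not at hx2
    have hk2 : k = 2 := by
      have : (k : ℝ) < 3 := by linarith
      have : k < 3 := by exact_mod_cast this
      omega
    subst hk2
    have h1' : (1 : ℝ) ≤ x := by norm_num at h1; exact h1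
    have hmax := Real.convexOn_Gamma.le_max_of_mem_Icc (x := 1) (y := 2) (z := x)
      (by norm_num) (by norm_num) ⟨h1', hx2.le⟩
    rw [Real.Gamma_one, Real.Gamma_two, max_self] at hmax
    norm_num
    exact hmax

end HutchcroftMoments

end Literature.Probability.Percolation
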